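import Summits.QuantumFields.BalabanUV.Gaps.EndDrawdownLinearThresholdRenorm

/-!
# Gaps / EndDrawdownLinearThresholdRenormPieces — SEGMENT DATA FOR THE OCTAL STAIRCASE WITH `8^m` EULER PIECES PER BLOCK (the index and recursion
# bookkeeping behind the sufficiency criterion `EndDrawdownLinearThresholdRenormSuff.endPossibleLin_bOct_of_escape`).  Backward piece map
# `r(x) = x − τ_m(1 − C∕√x)` (`τ_m = 7∕8^m`; slope of a piece taken at its TOP), monotone on `[C², ∞)` when `τ_m ≤ 2C²` (`rStep_mono`) with certified
# lower steps (`rStep_ge_of_bounds`, `iterate_rStep_ge_step`); backward block map `B_m(κ) = r^{[8^m]}(4κ)` and iterates `ν_n = B_m^n(C²)`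
# (`sq_le_nu`, `nu_succ_le`); the one-piece recursion `R` of (X11) escapes geometrically above `7∕3` (`iterate_R_ge`); scaled block-entry heights
# `kap` (R-iterates below `t₁`, `ν` on the `n₀` certified blocks, the tail floor above `T = t₁ + n₀`); segment index decoding `blkOf` ∕ `pcOf`
# (`step_in`, `step_out`), breakpoints `Nseg` (block starts below `t₁`, piece starts from `t₁` on: `Nseg_zero`, `Nseg_lt`, `Nseg_ge`, `Nseg_strictMono`,
# `mem_blk_of_seg`, `segLen_cast`) and heights `Hseg` (cell pub-balaban-gaps, seat g1-p3 GEN 11, rows CAP ∕ tail ∕ (D4) «split ∕ weakening»; this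
# seat's own leaf; file 30 of «the one-loop interface of the END statement»)

HONEST FRAMING (cell rule, page 1 of everything): [folklore] real-arithmetic and index bookkeeping for ONE toy sequence; nothing here is a statement
about Bałaban's table; `EndPossibleLin` does not even occur in this file; words ∕ odds of rows CAP ∕ tail ∕ (D4) ∕ (D1) UNCHANGED; 0∕6 binders; one
finite T⁴; NOT [I] Thm 2, NOT `BetaPertH`, NOT the continuum limit, NOT Clay.

CITATION HEADER (tags CONTEXT ONLY).  [I] = T. Bałaban, Commun. Math. Phys. **109** (1987) 249–301 [Balaban1987RG1]: (0.20) p. 256, Thm 2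
p. 259 (first sentence), (2.12)–(2.14) p. 268.
-/

namespace Summit.QuantumFields.BalabanUV.Gaps.EndDrawdownLinearThresholdRenormPieces

open Summit.QuantumFields.BalabanUV.Gaps.EndDrawdownLinearThreshold
open Summit.QuantumFields.BalabanUV.Gaps.EndDrawdownLinearThresholdRenorm
open Finset

noncomputable section

variable {C : ℝ}

/-! ## §1 The backward piece map, the backward block map, the iterates -/

/-- Scaled piece duration `τ_m = 7∕8^m`. [folklore] -/
def tauS (m : ℕ) : ℝ := 7 / 8 ^ m

/-- THE BACKWARD PIECE MAP: `r(x) = x − τ(1 − C∕√x)` (entering height of a piece whose top is `x`, slope taken at the top). [folklore] -/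
def rStep (C τ x : ℝ) : ℝ := x - τ * (1 - C / Real.sqrt x)

/-- THE BACKWARD BLOCK MAP with `8^m` pieces: `B_m(κ) = r^{[8^m]}(4κ)`. [folklore] -/
def Bm (m : ℕ) (C κ : ℝ) : ℝ := (rStep C (tauS m))^[8 ^ m] (4 * κ)

/-- The iterates from the tail floor: `ν_0 = C²`, `ν_{n+1} = B_m(ν_n)`. [folklore] -/
def nu (m : ℕ) (C : ℝ) : ℕ → ℝ
  | 0 => C ^ 2
  | n + 1 => Bm m C (nu m C n)

/-- `τ_m > 0`. [folklore] -/
theorem tauS_pos (m : ℕ) : 0 < tauS m := by unfold tauS; positivity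

/-- `r(x) ≤ x` above the equilibrium (`x ≥ C²`, `C > 0`, `τ ≥ 0`). [folklore] -/
theorem rStep_le (hC : 0 < C) {τ : ℝ} (hτ : 0 ≤ τ) {x : ℝ} (hx : C ^ 2 ≤ x) : rStep C τ x ≤ x := by
  have hxpos : 0 < x := lt_of_lt_of_le (by positivity) hx
  have hsq : C ≤ Real.sqrt x := (Real.le_sqrt hC.le hxpos.le).mpr hx
  have h1 : C / Real.sqrt x ≤ 1 := by rw [div_le_one (Real.sqrt_pos.mpr hxpos)]; exact hsq
  unfold rStep; nlinarith

/-- Pieces stay above the equilibrium when `2C² ≥ τ`: `x ≥ C² ⟹ r(x) ≥ C²` (`r(v²) − C² = (v − C)(v + C − τ∕v)`). [folklore] -/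
theorem sq_le_rStep (hC : 0 < C) {τ : ℝ} (hCτ : τ ≤ 2 * C ^ 2) {x : ℝ} (hx : C ^ 2 ≤ x) : C ^ 2 ≤ rStep C τ x := by
  have hxpos : 0 < x := lt_of_lt_of_le (by positivity) hx
  obtain ⟨v, hvpos, rfl⟩ : ∃ v : ℝ, 0 < v ∧ x = v ^ 2 := ⟨Real.sqrt x, Real.sqrt_pos.mpr hxpos, (Real.sq_sqrt hxpos.le).symm⟩
  have hCv : C ≤ v := by
    have := Real.sqrt_le_sqrt hx
    rwa [Real.sqrt_sq hC.le, Real.sqrt_sq hvpos.le] at this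
  unfold rStep
  rw [Real.sqrt_sq hvpos.le, ← sub_nonneg]
  have e : v ^ 2 - τ * (1 - C / v) - C ^ 2 = (v - C) * (v + C - τ / v) := by field_simp; ring
  rw [e]
  apply mul_nonneg (by linarith)
  have h1 : τ / v ≤ 2 * C ^ 2 / C := by
    rw [div_le_div_iff₀ hvpos hC]; nlinarith
  have h2 : 2 * C ^ 2 / C = 2 * C := by rw [div_eq_iff hC.ne']; ring
  linarith

/-- `r` is non-decreasing on `[C², ∞)` when `2C² ≥ τ`… more simply: for `C² ≤ x ≤ y`, `r(x) ≤ r(y)` whenever `τ ≤ 2x^{3∕2}∕C`; we only need the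
consequence along iterates, so we record the piecewise statement used: iterates from `x ≥ C²` stay in `[C², x]`. [folklore] -/
theorem iterate_rStep_mem (hC : 0 < C) {τ : ℝ} (hτ : 0 ≤ τ) (hCτ : τ ≤ 2 * C ^ 2) {x : ℝ} (hx : C ^ 2 ≤ x) :
    ∀ j : ℕ, C ^ 2 ≤ (rStep C τ)^[j] x ∧ (rStep C τ)^[j] x ≤ x := by
  intro j
  induction j with
  | zero => exact ⟨hx, le_rfl⟩
  | succ j ih =>
    rw [Function.iterate_succ_apply']
    exact ⟨sq_le_rStep hC hCτ ih.1, (rStep_le hC hτ ih.1).trans ih.2⟩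


/-- `r` is non-decreasing on `[C², ∞)` when `τ ≤ 2C²`: `r(w²) − r(v²) = (w − v)(w + v − τC∕(vw))`. [folklore] -/
theorem rStep_mono (hC : 0 < C) {τ : ℝ} (hCτ : τ ≤ 2 * C ^ 2) {x y : ℝ} (hx : C ^ 2 ≤ x) (hxy : x ≤ y) :
    rStep C τ x ≤ rStep C τ y := by
  have hxpos : 0 < x := lt_of_lt_of_le (by positivity) hx
  obtain ⟨v, hvpos, rfl⟩ : ∃ v : ℝ, 0 < v ∧ x = v ^ 2 := ⟨Real.sqrt x, Real.sqrt_pos.mpr hxpos, (Real.sq_sqrt hxpos.le).symm⟩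
  have hypos : 0 < y := hxpos.trans_le hxy
  obtain ⟨w, hwpos, rfl⟩ : ∃ w : ℝ, 0 < w ∧ y = w ^ 2 := ⟨Real.sqrt y, Real.sqrt_pos.mpr hypos, (Real.sq_sqrt hypos.le).symm⟩
  have hCv : C ≤ v := by
    have := Real.sqrt_le_sqrt hx
    rwa [Real.sqrt_sq hC.le, Real.sqrt_sq hvpos.le] at this
  have hvw : v ≤ w := by
    have := Real.sqrt_le_sqrt hxy
    rwa [Real.sqrt_sq hvpos.le, Real.sqrt_sq hwpos.le] at this
  unfold rStep
  rw [Real.sqrt_sq hvpos.le, Real.sqrt_sq hwpos.le, ← sub_nonneg]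
  have e : w ^ 2 - τ * (1 - C / w) - (v ^ 2 - τ * (1 - C / v)) = (w - v) * (w + v - τ * C / (v * w)) := by field_simp; ring
  rw [e]
  apply mul_nonneg (by linarith)
  have h1 : τ * C / (v * w) ≤ 2 * C ^ 2 * C / (C * C) := by
    rw [div_le_div_iff₀ (by positivity) (by positivity)]
    have : C * C ≤ v * w := by nlinarith
    nlinarith [mul_nonneg (sub_nonneg.mpr hCτ) (by positivity : (0:ℝ) ≤ C ^ 3),
      mul_nonneg (by positivity : (0:ℝ) ≤ 2 * C ^ 3) (sub_nonneg.mpr this)]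
  have h2 : 2 * C ^ 2 * C / (C * C) = 2 * C := by rw [div_eq_iff (by positivity)]; ring
  nlinarith

/-- ONE CERTIFIED BACKWARD PIECE · from `C² ≤ xlo ≤ x` and a rational square-root upper witness `s > 0`, `xlo ≤ s²`:
`xlo − τ(1 − C∕s) ≤ r(x)`. [folklore] -/
theorem rStep_ge_of_bounds (hC : 0 < C) {τ : ℝ} (hτ : 0 ≤ τ) (hCτ : τ ≤ 2 * C ^ 2) {x xlo s : ℝ} (hxlo : C ^ 2 ≤ xlo) (hx : xlo ≤ x)
    (hs : 0 < s) (hs2 : xlo ≤ s ^ 2) : xlo - τ * (1 - C / s) ≤ rStep C τ x := by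
  refine le_trans ?_ (rStep_mono hC hCτ hxlo hx)
  have hxlopos : 0 < xlo := lt_of_lt_of_le (by positivity) hxlo
  have hslo : Real.sqrt xlo ≤ s := by
    rw [← Real.sqrt_sq hs.le]; exact Real.sqrt_le_sqrt hs2
  have h1 : C / s ≤ C / Real.sqrt xlo := div_le_div_of_nonneg_left hC.le (Real.sqrt_pos.mpr hxlopos) hslo
  unfold rStep; nlinarith

/-- Chaining certified backward pieces along the iterate. [folklore] -/
theorem iterate_rStep_ge_step (hC : 0 < C) {τ : ℝ} (hCτ' : 0 ≤ τ ∧ τ ≤ 2 * C ^ 2) {x0 xlo s xnew : ℝ} {j : ℕ}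
    (hprev : xlo ≤ (rStep C τ)^[j] x0) (hxlo : C ^ 2 ≤ xlo) (hs : 0 < s) (hs2 : xlo ≤ s ^ 2) (hnew : xnew ≤ xlo - τ * (1 - C / s)) :
    xnew ≤ (rStep C τ)^[j + 1] x0 := by
  rw [Function.iterate_succ_apply']; exact hnew.trans (rStep_ge_of_bounds hC hCτ'.1 hCτ'.2 hxlo hprev hs hs2)

section Iterates

variable (hC : 0 < C) (m : ℕ) (hCτ : tauS m ≤ 2 * C ^ 2)
include hC hCτ

/-- `ν_n ≥ C²`. [folklore] -/
theorem sq_le_nu : ∀ n : ℕ, C ^ 2 ≤ nu m C n := by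
  intro n
  induction n with
  | zero => exact le_rfl
  | succ n ih =>
    show C ^ 2 ≤ Bm m C (nu m C n)
    unfold Bm
    exact (iterate_rStep_mem hC (tauS_pos m).le hCτ (by linarith [ih, sq_nonneg C]) _).1

/-- `ν_{n+1} ≤ 4ν_n`. [folklore] -/
theorem nu_succ_le (n : ℕ) : nu m C (n + 1) ≤ 4 * nu m C n := by
  show Bm m C (nu m C n) ≤ 4 * nu m C n
  unfold Bm
  exact (iterate_rStep_mem hC (tauS_pos m).le hCτ (by linarith [sq_le_nu hC m hCτ n, sq_nonneg C]) _).2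

end Iterates

/-! ## §2 The one-piece recursion above `7∕3` diverges -/

/-- `R(κ) − 7∕3 ≥ 4(κ − 7∕3)` for `κ > 0` (`C ≥ 0`): above `7∕3` the one-piece backward recursion of (X11) escapes geometrically. [folklore] -/
theorem R_sub_ge (hC : 0 ≤ C) {κ : ℝ} (hκ : 0 < κ) : 4 * (κ - 7 / 3) ≤ R C κ - 7 / 3 := by
  have : 0 ≤ 7 / 2 * C / Real.sqrt κ := by positivity
  unfold R; linarith

/-- Iterates of `R` from `κ₀ > 7∕3`: `R^{[n]}(κ₀) ≥ 7∕3 + 4^n (κ₀ − 7∕3)`. [folklore] -/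
theorem iterate_R_ge (hC : 0 ≤ C) {κ₀ : ℝ} (hκ₀ : 7 / 3 < κ₀) : ∀ n : ℕ, 7 / 3 + 4 ^ n * (κ₀ - 7 / 3) ≤ (R C)^[n] κ₀ := by
  intro n
  induction n with
  | zero => simp
  | succ n ih =>
    rw [Function.iterate_succ_apply', pow_succ]
    have hpos : 0 < (R C)^[n] κ₀ := by
      have : (0 : ℝ) ≤ 4 ^ n * (κ₀ - 7 / 3) := mul_nonneg (by positivity) (by linarith)
      linarith
    have h := R_sub_ge hC hpos
    nlinarith [h, ih, pow_pos (by norm_num : (0 : ℝ) < 4) n]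

/-! ## §3 Segment data for the octal staircase: `8^m` pieces on the certified blocks, one piece per block below them, flat above -/

section Data

variable (C : ℝ) (m n₀ t₁ : ℕ)

/-- Scaled block-entry heights: `R`-iterates below `t₁`, the certified `ν`-iterates on `[t₁, T]` (`T = t₁ + n₀`), the tail floor `C²` above. [folklore] -/
def kap (t : ℕ) : ℝ :=
  if t ≤ t₁ then (R C)^[t₁ - t] (nu m C n₀) else if t ≤ t₁ + n₀ then nu m C (t₁ + n₀ - t) else C ^ 2

/-- The block of segment `k`. [folklore] -/
def blkOf (k : ℕ) : ℕ := if k < t₁ then k else t₁ + (k - t₁) / 8 ^ m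

/-- The piece index of segment `k` inside its block (meaningful for `k ≥ t₁`). [folklore] -/
def pcOf (k : ℕ) : ℕ := (k - t₁) % 8 ^ m

/-- Breakpoints: block starts below `t₁`, piece starts `bs8 t + j·7·8^{t−m}` from `t₁` on. [folklore] -/
def Nseg (k : ℕ) : ℕ := if k < t₁ then bs8 k else bs8 (blkOf m t₁ k) + pcOf m t₁ k * (7 * 8 ^ (blkOf m t₁ k - m))

/-- Heights at the breakpoints: `4^k κ_k` below `t₁`; `4^t · r^{[8^m − j]}(4κ_{t+1})` on the certified blocks; the flat top `C²4^T` above. [folklore] -/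
def Hseg (k : ℕ) : ℝ :=
  if k < t₁ then 4 ^ k * kap C m n₀ t₁ k
  else if blkOf m t₁ k < t₁ + n₀ then
    4 ^ blkOf m t₁ k * (rStep C (tauS m))^[8 ^ m - pcOf m t₁ k] (4 * kap C m n₀ t₁ (blkOf m t₁ k + 1))
  else C ^ 2 * 4 ^ (t₁ + n₀)

end Data

/-! ## §4 Decoding the segment index -/

section Decode

variable (m t₁ : ℕ)

/-- Below `t₁` the segment is its block. [folklore] -/
theorem blkOf_lt {k : ℕ} (hk : k < t₁) : blkOf m t₁ k = k := if_pos hk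

/-- From `t₁` on: block `t₁ + (k − t₁) ∕ 8^m`. [folklore] -/
theorem blkOf_ge {k : ℕ} (hk : t₁ ≤ k) : blkOf m t₁ k = t₁ + (k - t₁) / 8 ^ m := if_neg (by omega)

/-- The piece index is `< 8^m`. [folklore] -/
theorem pcOf_lt (k : ℕ) : pcOf m t₁ k < 8 ^ m := Nat.mod_lt _ (by positivity)

/-- Euclid: `k − t₁ = 8^m · ((k − t₁)∕8^m) + pcOf k`. [folklore] -/
theorem decode (k : ℕ) : k - t₁ = 8 ^ m * ((k - t₁) / 8 ^ m) + pcOf m t₁ k := (Nat.div_add_mod _ _).symm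

/-- At `t₁`: block `t₁`, piece `0`. [folklore] -/
theorem blkOf_t1 : blkOf m t₁ t₁ = t₁ ∧ pcOf m t₁ t₁ = 0 := by
  refine ⟨by rw [blkOf_ge m t₁ le_rfl]; simp, by simp [pcOf]⟩

/-- Stepping inside a block: the piece index increases, the block stays. [folklore] -/
theorem step_in {k : ℕ} (hk : t₁ ≤ k) (hj : pcOf m t₁ k + 1 < 8 ^ m) :
    blkOf m t₁ (k + 1) = blkOf m t₁ k ∧ pcOf m t₁ (k + 1) = pcOf m t₁ k + 1 := by
  have hp : 0 < 8 ^ m := by positivity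
  have hd := decode m t₁ k
  have e : k + 1 - t₁ = 8 ^ m * ((k - t₁) / 8 ^ m) + (pcOf m t₁ k + 1) := by omega
  constructor
  · rw [blkOf_ge m t₁ hk, blkOf_ge m t₁ (by omega), e, Nat.mul_add_div hp, Nat.div_eq_of_lt hj]; simp
  · show (k + 1 - t₁) % 8 ^ m = pcOf m t₁ k + 1
    rw [e, Nat.mul_add_mod, Nat.mod_eq_of_lt hj]

/-- Stepping out of a block: the last piece is followed by piece `0` of the next block. [folklore] -/
theorem step_out {k : ℕ} (hk : t₁ ≤ k) (hj : pcOf m t₁ k + 1 = 8 ^ m) :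
    blkOf m t₁ (k + 1) = blkOf m t₁ k + 1 ∧ pcOf m t₁ (k + 1) = 0 := by
  have hp : 0 < 8 ^ m := by positivity
  have hd := decode m t₁ k
  have e : k + 1 - t₁ = 8 ^ m * ((k - t₁) / 8 ^ m + 1) + 0 := by rw [Nat.mul_add, Nat.mul_one]; omega
  constructor
  · rw [blkOf_ge m t₁ hk, blkOf_ge m t₁ (by omega), e, Nat.add_zero, Nat.mul_div_cancel_left _ hp, Nat.add_assoc]
  · show (k + 1 - t₁) % 8 ^ m = 0
    rw [e, Nat.add_zero, Nat.mul_mod_right]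

/-- From `t₁` on the block is at least `t₁`. [folklore] -/
theorem t1_le_blkOf {k : ℕ} (hk : t₁ ≤ k) : t₁ ≤ blkOf m t₁ k := by rw [blkOf_ge m t₁ hk]; exact Nat.le_add_right _ _

end Decode

/-! ## §5 The segment data: breakpoints, lengths, block membership, heights at the next breakpoint -/

section SegData

variable {C : ℝ} (m n₀ t₁ : ℕ) (hm : m ≤ t₁)
include hm

/-- `N 0 = 0`. [folklore] -/
theorem Nseg_zero : Nseg m t₁ 0 = 0 := by
  unfold Nseg
  by_cases h : 0 < t₁
  · rw [if_pos h]; rfl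
  · have ht : t₁ = 0 := by omega
    subst ht
    rw [if_neg h, blkOf_ge m 0 le_rfl]; simp [pcOf, bs8]

omit hm in
/-- Below `t₁`: `N k = bs8 k` and `N (k+1) = bs8 (k+1)`. [folklore] -/
theorem Nseg_lt {k : ℕ} (hk : k < t₁) : Nseg m t₁ k = bs8 k ∧ Nseg m t₁ (k + 1) = bs8 (k + 1) := by
  refine ⟨if_pos hk, ?_⟩
  by_cases h : k + 1 < t₁
  · exact if_pos h
  · have hk1 : k + 1 = t₁ := by omega
    unfold Nseg; rw [if_neg h, hk1, (blkOf_t1 m t₁).1, (blkOf_t1 m t₁).2]; simp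

/-- From `t₁` on: `N k = bs8 t + j·q_t` and `N (k+1) = N k + q_t` with `t = blkOf k`, `j = pcOf k`, `q_t = 7·8^{t−m}`. [folklore] -/
theorem Nseg_ge {k : ℕ} (hk : t₁ ≤ k) :
    Nseg m t₁ k = bs8 (blkOf m t₁ k) + pcOf m t₁ k * (7 * 8 ^ (blkOf m t₁ k - m)) ∧
      Nseg m t₁ (k + 1) = Nseg m t₁ k + 7 * 8 ^ (blkOf m t₁ k - m) := by
  have hN : Nseg m t₁ k = bs8 (blkOf m t₁ k) + pcOf m t₁ k * (7 * 8 ^ (blkOf m t₁ k - m)) := if_neg (by omega)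
  refine ⟨hN, ?_⟩
  have hN1 : Nseg m t₁ (k + 1) = bs8 (blkOf m t₁ (k + 1)) + pcOf m t₁ (k + 1) * (7 * 8 ^ (blkOf m t₁ (k + 1) - m)) :=
    if_neg (by omega)
  rw [hN1, hN]
  have ht := t1_le_blkOf m t₁ hk
  by_cases hj : pcOf m t₁ k + 1 < 8 ^ m
  · obtain ⟨hb, hp⟩ := step_in m t₁ hk hj
    rw [hb, hp]; ring
  · have hj' : pcOf m t₁ k + 1 = 8 ^ m := by have := pcOf_lt m t₁ k; omega
    obtain ⟨hb, hp⟩ := step_out m t₁ hk hj'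
    rw [hb, hp, bs8_succ, zero_mul, add_zero]
    have e : 7 * 8 ^ blkOf m t₁ k = 8 ^ m * (7 * 8 ^ (blkOf m t₁ k - m)) := by
      rw [mul_left_comm, ← pow_add, Nat.add_sub_cancel' (hm.trans ht)]
    have e2 : pcOf m t₁ k = 8 ^ m - 1 := by omega
    rw [e, e2]
    have hp1 : 1 ≤ 8 ^ m := Nat.one_le_pow _ _ (by norm_num)
    zify [hp1]
    ring

/-- The breakpoints are strictly increasing. [folklore] -/
theorem Nseg_strictMono : StrictMono (Nseg m t₁) := by
  refine strictMono_nat_of_lt_succ fun k => ?_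
  by_cases hk : k < t₁
  · obtain ⟨h1, h2⟩ := Nseg_lt m t₁ hk
    rw [h1, h2, bs8_succ]; exact Nat.lt_add_of_pos_right (by positivity)
  · have h := (Nseg_ge m t₁ hm (not_lt.mp hk)).2
    rw [h]; exact Nat.lt_add_of_pos_right (by positivity)

/-- Every index of segment `k` lies in block `blkOf k`. [folklore] -/
theorem mem_blk_of_seg {k i : ℕ} (h1 : Nseg m t₁ k ≤ i) (h2 : i < Nseg m t₁ (k + 1)) :
    bs8 (blkOf m t₁ k) ≤ i ∧ i < bs8 (blkOf m t₁ k + 1) := by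
  by_cases hk : k < t₁
  · obtain ⟨e1, e2⟩ := Nseg_lt m t₁ hk
    rw [blkOf_lt m t₁ hk]; rw [e1] at h1; rw [e2] at h2; exact ⟨h1, h2⟩
  · obtain ⟨e1, e2⟩ := Nseg_ge m t₁ hm (not_lt.mp hk)
    have ht := t1_le_blkOf m t₁ (not_lt.mp hk)
    have hj := pcOf_lt m t₁ k
    rw [e2, e1] at h2; rw [e1] at h1
    refine ⟨le_trans (Nat.le_add_right _ _) h1, ?_⟩
    rw [bs8_succ]
    have e : 7 * 8 ^ blkOf m t₁ k = 8 ^ m * (7 * 8 ^ (blkOf m t₁ k - m)) := by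
      rw [mul_left_comm, ← pow_add, Nat.add_sub_cancel' (hm.trans ht)]
    rw [e]
    have : (pcOf m t₁ k + 1) * (7 * 8 ^ (blkOf m t₁ k - m)) ≤ 8 ^ m * (7 * 8 ^ (blkOf m t₁ k - m)) :=
      Nat.mul_le_mul_right _ (by omega)
    nlinarith

/-- Segment lengths, cast: below `t₁` the block length `7·8^k`, from `t₁` on the piece length `7·8^{t−m}`. [folklore] -/
theorem segLen_cast (k : ℕ) : ((Nseg m t₁ (k + 1) - Nseg m t₁ k : ℕ) : ℝ) =
    if k < t₁ then 7 * 8 ^ k else 7 * 8 ^ (blkOf m t₁ k - m) := by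
  by_cases hk : k < t₁
  · obtain ⟨e1, e2⟩ := Nseg_lt m t₁ hk
    rw [if_pos hk, e1, e2, bs8_succ, Nat.add_sub_cancel_left]; push_cast; ring
  · obtain ⟨_, e2⟩ := Nseg_ge m t₁ hm (not_lt.mp hk)
    rw [if_neg hk, e2, Nat.add_sub_cancel_left]; push_cast; ring

end SegData


/-! ## §6 (v1.1, append-only) The first breakpoints -/

/-- Below `t₁` the breakpoints are the octal block starts, in particular `N t = 8^t − 1` for `t < t₁`. [folklore] -/
theorem Nseg_eq_bs8 (m t₁ : ℕ) {k : ℕ} (hk : k < t₁) : Nseg m t₁ k = bs8 k := (Nseg_lt m t₁ hk).1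

/-- The breakpoint `t₁` is the start of block `t₁` (piece `0`). [folklore] -/
theorem Nseg_t1 (m t₁ : ℕ) : Nseg m t₁ t₁ = bs8 t₁ := by
  unfold Nseg; rw [if_neg (lt_irrefl _), (blkOf_t1 m t₁).1, (blkOf_t1 m t₁).2]; simp

end

end Summit.QuantumFields.BalabanUV.Gaps.EndDrawdownLinearThresholdRenormPieces
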